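import Summits.QuantumFields.YangMills.Theorems.BalabanUVNodesN07NormalisationOfRecordWide
import Summits.QuantumFields.YangMills.Theorems.UnitScaleTiltProp8ChartDoubleBarAccumulated
import HarnessLib

/-!
# N07 [B11] (= [15] = [Balaban1985Variational]) Sect. F — **THE NORMALISATION OF RECORD IN DOUBLE-BAR CURRENCY** `NrmDbarOfRecord`: MODULE 60′'s `NrmOfRecordWide` with its
# unit-block-average conjunct ([3] (78)∕(87): «u(y) = (R̄_{0,y}U₁^{(k)})⁻¹» at the cell centres) read in the ACCUMULATED SYMMETRIC BLOCK FRAMES of the UST double-bar chart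
# ([3] (97); `Prop8ChartDoubleBar.vframeU ∕ dbarIterU`) — so that, by print's FUNDAMENTAL EQUALITY (92)∕(99) (UST ✓`dbarIterU_gaugeActT_eq`), the DOUBLE-BAR averages of the
# Landau copy `U^u` EQUAL the plain averages of the axial representative `(U^w)^{h̄}` EXACTLY at every cell bond, and (by UST ✓`…DoubleBarLogSecondOrder` :273) linearise to the FLAT
# tube averages `Q_j` the chart reads — cure (α‴) of ⚑ LOCATED-CPRIME-CURRENCY with NO new analysis

Cell `pub-ymgap`, seat `pub-ymgap-dag-n07-e` g27 (FAN-OUT §N07 row s3; LANE OWNER of the K0 road), MODULE 91 (INTENT-91, cell bus).  `--kind definition --supports stmt-QuantumFields-20541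
--as helper` (K0⁷); count-neutral.  ONE `def` (a displayed predicate, NEVER asserted) + one `abbrev` (the units reading of a gauge transformation) + bookkeeping theorems; nothing landed is
edited: 60′ `NrmOfRecordWide` (radial-sheared currency) and 87 `NrmSymOfRecord` (Federbush-contour currency) stay in the tree as alternative texts, superseded BY NAME if the plan so rules.
[15] = [Balaban1985Variational]; [3] = [Balaban1985Averaging]; [6] = [Balaban1985RegularSpaces]; [I] = [Balaban1987RG1].

WHY (desk memo `LOCATED-CPRIME-CURRENCY.md`; plan RULINGS A3″→A3‴).  The chart half of the K0 road is in FLAT-tube ∕ DOUBLE-BAR currency (k0-s1's flat chart, `chartLogFlat`, `dbarIterU`, 76,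
82a∕82b; the ONLY proven first-order linearisation `log U̿^{(j)}(e^{iηA}) = iηLʲQ_jA + O(2)` is UST's, for `dbarIterU`); the normalisation half (60′: «`R̄^{j′}g = 1`» with [3] (78)'s
base-point-factored block average, hence (84) `g↾ = S^{rad}(U^u)⁻¹` with the RADIAL (85)-frames) makes the RADIAL-sheared averages equal the axial data — a different first-order currency
(in-block curvature fluxes in between; the (c′) letter on the seam).  [3] ITSELF proves that the level-by-level («recomputed») frames and the ACCUMULATED frames agree ((92)∕(97)∕(99)), and
UST typed exactly that at background `1` for the symmetric centred objects: `dbarIterU j (U^{us 0}) = (Ū^{(j)} U)^{V_j⁻¹·us j}` for the accumulated frames `V` of `U^{us 0}`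
(`V 0 = 1`, `V (i+1) y = V i (emb y)·vframeU (dbarIterU i (U^{us 0})) y`) and ANY coarse reading `us` of a fine gauge map (`us (i+1) y = us i (emb y)`).  So the normalisation that
makes the chart's own objects equal the axial data is (87) IN THOSE FRAMES: «`V_{j′}(U^u)(y)⁻¹ · u(y) = (h̄·w)(y)` at every cell centre `y` of `Λ′_{j′}(D″)`» — ONE group equation per
cell SITE (well-posed, like (1.29)), after which `U̿^{(j′)}(U^u)(c) = Ū^{(j′)}((U^w)^{h̄})(c)` EXACTLY on every cell bond (both ends cells) by pure algebra.  THIS FILE types that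
predicate and that identity.  The (c′) letter then follows BY NAME from UST :273 + the δ-rows of the axial data (MODULES 62∕71∕75∕81, unchanged object `M^{j′}((U^w)^{h̄})`) + dag-n07-w2's
guard dictionary `emlIterU_unitsField_eq_iter_of_reads` — no new analysis (the (α″) road's one new linearisation theorem is not needed).

WHAT THIS FILE DECLARES ∕ PROVES (sorry-free; axioms standard; NOTHING of [15]∕[3]∕[6]∕[I] analysis).
* §1 `toUT g` (abbrev) — a gauge transformation `T^{(i)} → SU(N)` read in the units of `M_N(ℂ)` (`Unitary.toUnits ∘ suIncl`, the reading of `unitsField ∘ toUField`);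
  `unitsField_toUField_gaugeAct` (`(U^g)♮ = (U♮)^{toUT g}`, any level), `toUT_toMS_succ` (the tower `toMS` reads at iterated centres: `hus` of UST §5).
* §2 `NrmDbarOfRecord F N Mc ρ : <MODULE 59's `Nrm` type>` — 60′'s residual∕radial-axial∕rooted-top-gauge clauses VERBATIM, and, for every level `j′ ≤ j`, every accumulated-frame
  family `V` of `(U^u)♮` (displayed recursion) and every cell site `y` of `D″` at level `j′`: `(V j′ y)⁻¹ · toUT (toMS u j′) y = toUT (toMS (h̄·w) j′) y`.  NEVER asserted.
* §3 ★★★ `NrmDbarOfRecord.dbar_eq_iter_rep` — under the predicate, for the witness `w` and every cell bond `c` of `D″` at level `j′ ≤ j`: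
  `dbarIterU j′ ((U^u)♮) c = emlIterU j′ (((U^w)^{h̄})♮) c` (UST `dbarIterU_gaugeActT_eq` + `emlIterU_gaugeActT` + the per-site equation at both ends);
  ★★ `NrmDbarOfRecord.dbar_eq_top_dataAxial` — at the top level `j′ = j`: `= Ū^{(j)}_{eml}(((M^jU… )))` read as `emlIterU j ((U^{h̄w})♮) c` with `M^j(U^w) = M^jU` recorded (`w` residual).
HONEST SCOPE.  One displayed predicate (it DISCHARGES NOTHING) + kernel algebra over LANDED theorems (UST's, 60′'s); the door for this predicate is the CONDITIONAL premise `HThm4Rec`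
re-texted at it (S, to follow on the plan's word); whether THIS is the `Nrm` text of record is the plan's ruling (asked with this file as the falsifier); HS3NORM ∕ HCHART ∕ HBUDGET stay
displayed; K0⁷ ∕ K1⁹ NOT closed; N07 ∕ N05 NOT discharged; counts unmoved (typed 28∕28 · discharged 8∕27 per the chair); one finite 𝕋⁴ programme at fixed ε — the route closes the
conditional finite-𝕋⁴ rung `BalabanLadder.UV` ONLY; the YM mass gap (Clay) is NOT proved by any of this; nothing continuum ∕ ℝ⁴ ∕ OS.  ONE `def` + one `abbrev`, no `instance`, no
`notation`, no `sorry`.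

References: [3] (11) p. 19, (78)–(82) p. 30, (85)–(92) p. 31, (97)–(100) p. 32; [15] (144) p. 300, (147) p. 301, (150)–(156) pp. 301–302; [6] (1.15) p. 78, (1.29) p. 81; [I] (0.4), (0.11) p. 253.
-/

set_option autoImplicit false

noncomputable section

open scoped Matrix.Norms.L2Operator

namespace Summit.QuantumFields.YangMills.BalabanUVNodes.N07NormalisationDbarFrames

open Literature.MathematicalPhysics.QuantumFieldTheory.Balaban1983to89
open Literature.MathematicalPhysics.QuantumFieldTheory.Balaban1983to89.Node00
open T4Continuum (T4Family)
open T4AxialGaugeRooted (axialGaugeAt)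
open B12GaugeOrbits021 (IsResidual)
open B15Eq177GaugeInvariance (blockLift)
open B16Sect1Backgrounds (toMS)
open B14DomainGeom (Pt)
open B8Eq131Cubes (tLo tHi ctr)
open GaugeField (gaugeAct)
open B10Eq27TorusAxialLog (unitsField toUField suIncl gaugeActT gaugeActT_apply val_unitsField)
open Summit.QuantumFields.Balaban3D.Carriers (radialContourData)
open Summit.QuantumFields.YangMills.Theorems.Prop8Chart (emlIterU emlIterU_gaugeActT)
open Summit.QuantumFields.YangMills.Theorems.Prop8ChartDoubleBar (vframeU dbarIterU dbarIterU_gaugeActT_eq)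

/-! ## §1  Gauge transformations read in the units of `M_N(ℂ)` -/

/-- A gauge transformation `T^{(i)} → SU(N)` read in `M_N(ℂ)ˣ` (the reading of `unitsField ∘ toUField` on the fields). [cite: Balaban1985Averaging, (19) p.21 (bookkeeping)] -/
abbrev toUT {P : Params} {i : ℕ} {N : ℕ} [NeZero N] (g : GaugeTransf P i (SU N)) : GaugeTransf P i (Matrix (Fin N) (Fin N) ℂ)ˣ :=
  fun x => Unitary.toUnits (suIncl (g x))

/-- `(U^g)♮ = (U♮)^{toUT g}` at every level ([3] (8)∕(11) in the units reading). [cite: Balaban1985Averaging, (8) p.19, (11) p.19 (bookkeeping)] -/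
theorem unitsField_toUField_gaugeAct {P : Params} {i : ℕ} {N : ℕ} [NeZero N] (g : GaugeTransf P i (SU N)) (U : GaugeField P i (SU N)) :
    unitsField (toUField (gaugeAct g U)) = gaugeActT (toUT g) (unitsField (toUField U)) := by
  funext b
  apply Units.ext
  rw [val_unitsField, gaugeActT_apply]
  rfl

/-- The centre tower of a fine gauge map reads at iterated centres: `toUT (toMS u (i+1)) y = toUT (toMS u i) (emb y)` (the hypothesis `hus` of UST's (92)). [cite: Balaban1987RG1, (0.1) p.251 (bookkeeping)] -/
theorem toUT_toMS_succ {P : Params} {N : ℕ} [NeZero N] (u : GaugeTransf P 0 (SU N)) (i : ℕ) (y : Site P (i + 1)) :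
    toUT (toMS u (i + 1)) y = toUT (toMS u i) (emb y) := rfl

/-! ## §2  The definition -/

/-- **THE NORMALISATION OF RECORD IN DOUBLE-BAR CURRENCY** — MODULE 60′'s `NrmOfRecordWide` with [3] (87) «`u(y) = (R̄_{0,y}U₁^{(k)})⁻¹`» read in the ACCUMULATED SYMMETRIC BLOCK
FRAMES of the UST double-bar chart ((97); `vframeU`, recomputed from the previous double-bar level): for the datum `(j, idx)`, the minimiser `U` and S3's gauge `u`, there is a residual
`w` of level `j` with `U^{w}` radial-axial below `j` such that, for every family `V` of accumulated frames of the Landau copy `(U^u)♮` (`V 0 = 1`,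
`V (i+1) y = V i (emb y)·vframeU (dbarIterU i (U^u)♮) y`), at every cell site `y ∈ Λ′_{j′}(D″)`, `j′ ≤ j`:  `V_{j′}(y)⁻¹ · u(y) = (h̄·w)(y)` — `h` the top axial gauge of `M^j(U^w)` on
print's window `□̃` rooted at its centre.  ONE group equation per cell SITE (as (1.29)).  A displayed predicate, NEVER asserted.
[cite: Balaban1985Averaging, (87) p.31, (92) p.31, (97) p.32; Balaban1985Variational, (144) p.300, (147) p.301, (150)–(154) pp.301–302; Balaban1985RegularSpaces, (1.15) p.78, (1.29) p.81; Balaban1987RG1, (0.11) p.253] -/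
def NrmDbarOfRecord (F : T4Family) (N : ℕ) [NeZero N] (Mc ρ : ℕ) :
    ∀ (ν : Stage7Numerics) (M : ℕ) (g : ℕ → ℝ) (K k : ℕ), SeqOfRecord F ν M g K k → GaugeField (F.P K) 0 (SU N) → ℕ → Pt (F.P K).d →
      GaugeTransf (F.P K) 0 (SU N) → (PBond (F.P K) 0 → MatA N) → Prop :=
  fun _ν _M _g K _k s U j idx u _A =>
    ∃ w : GaugeTransf (F.P K) 0 (SU N), IsResidual j w ∧
      (∀ i < j, AxialGauge (radialContourData (F.P K) i (SU N)) (Averaging.iter (avOfRecord F N K) i (gaugeAct w U))) ∧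
      ∀ (hk : j ≤ (F.P K).m + (F.P K).K) (V : (i : ℕ) → Site (F.P K) i → (Matrix (Fin N) (Fin N) ℂ)ˣ),
        (∀ x, V 0 x = 1) →
        (∀ (i : ℕ) (y : Site (F.P K) (i + 1)), V (i + 1) y = V i (emb y) * vframeU (dbarIterU i (unitsField (toUField (gaugeAct u U)))) y) →
        ∀ (j' : ℕ), j' ≤ j → ∀ y : Site (F.P K) j',
          (domainsMeet (cubeDomains (F.P K) (cornerP (F.P K) Mc ρ idx) (sideP (F.P K) Mc ρ) ρ j hk) (domainsOfSeq s.Ω j hk)).LamSite j' y →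
            (V j' y)⁻¹ * toUT (toMS u j') y =
              toUT (toMS (fun x => blockLift j (axialGaugeAt (Averaging.iter (avOfRecord F N K) j (gaugeAct w U))
                  (tLo (cornerP (F.P K) Mc ρ idx) ρ) (tHi (cornerP (F.P K) Mc ρ idx) (sideP (F.P K) Mc ρ) ρ) (ctr (cornerP (F.P K) Mc ρ idx) (sideP (F.P K) Mc ρ))) x * w x) j') y

/-! ## §3  The double-bar averages of the Landau copy ARE the plain averages of the representative (print's (92), by name) -/

section Derived

variable {F : T4Family} {N : ℕ} [NeZero N]

/-- ★★★ **UNDER `NrmDbarOfRecord`, `U̿^{(j′)}(U^u)(c) = Ū^{(j′)}((U^w)^{h̄})(c)` AT EVERY CELL BOND** (`j′ ≤ j`, both ends cell sites of `D″`): UST's fundamental equality (92)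
`dbarIterU_gaugeActT_eq` for the reading `toUT ∘ toMS u`, then the per-site equation at both ends, then the covariance `emlIterU_gaugeActT` for `toUT ∘ toMS (h̄·w)` backwards.
Pure algebra; no smallness. [cite: Balaban1985Averaging, (11) p.19, (87)–(88) p.31, (92) p.31, (97)–(99) p.32; Balaban1985Variational, (154) p.302] -/
theorem NrmDbarOfRecord.dbar_eq_iter_rep {Mc ρ : ℕ} {ν : Stage7Numerics} {M : ℕ} {g : ℕ → ℝ} {K k : ℕ}
    {s : SeqOfRecord F ν M g K k} {U : GaugeField (F.P K) 0 (SU N)} {j : ℕ} {idx : Pt (F.P K).d} {u : GaugeTransf (F.P K) 0 (SU N)}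
    {A : PBond (F.P K) 0 → MatA N} (hN : NrmDbarOfRecord F N Mc ρ ν M g K k s U j idx u A) (hk : j ≤ (F.P K).m + (F.P K).K) :
    ∃ w : GaugeTransf (F.P K) 0 (SU N), IsResidual j w ∧
      (∀ i < j, AxialGauge (radialContourData (F.P K) i (SU N)) (Averaging.iter (avOfRecord F N K) i (gaugeAct w U))) ∧
      ∀ (j' : ℕ) (_ : j' ≤ j) (c : PBond (F.P K) j'),
        (domainsMeet (cubeDomains (F.P K) (cornerP (F.P K) Mc ρ idx) (sideP (F.P K) Mc ρ) ρ j hk) (domainsOfSeq s.Ω j hk)).LamSite j' c.src →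
        (domainsMeet (cubeDomains (F.P K) (cornerP (F.P K) Mc ρ idx) (sideP (F.P K) Mc ρ) ρ j hk) (domainsOfSeq s.Ω j hk)).LamSite j' c.tgt →
          dbarIterU j' (unitsField (toUField (gaugeAct u U))) c =
            emlIterU j' (unitsField (toUField (gaugeAct (fun x => blockLift j (axialGaugeAt (Averaging.iter (avOfRecord F N K) j (gaugeAct w U))
              (tLo (cornerP (F.P K) Mc ρ idx) ρ) (tHi (cornerP (F.P K) Mc ρ idx) (sideP (F.P K) Mc ρ) ρ) (ctr (cornerP (F.P K) Mc ρ idx) (sideP (F.P K) Mc ρ))) x * w x) U))) c := by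
  obtain ⟨w, hres, hax, hnorm⟩ := hN
  refine ⟨w, hres, hax, fun j' hj' c hs ht => ?_⟩
  -- names: the axial representative's gauge map `g = h̄·w`, the accumulated frames `V` of `(U^u)♮` (defined by the recursion)
  set gw : GaugeTransf (F.P K) 0 (SU N) := fun x => blockLift j (axialGaugeAt (Averaging.iter (avOfRecord F N K) j (gaugeAct w U))
      (tLo (cornerP (F.P K) Mc ρ idx) ρ) (tHi (cornerP (F.P K) Mc ρ idx) (sideP (F.P K) Mc ρ) ρ) (ctr (cornerP (F.P K) Mc ρ idx) (sideP (F.P K) Mc ρ))) x * w x with hgw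
  let V : (i : ℕ) → Site (F.P K) i → (Matrix (Fin N) (Fin N) ℂ)ˣ := fun i =>
    Nat.rec (motive := fun i => Site (F.P K) i → (Matrix (Fin N) (Fin N) ℂ)ˣ) (fun _ => 1)
      (fun i Vi y => Vi (emb y) * vframeU (dbarIterU i (unitsField (toUField (gaugeAct u U)))) y) i
  have hV0 : ∀ x, V 0 x = 1 := fun _ => rfl
  have hVs : ∀ (i : ℕ) (y : Site (F.P K) (i + 1)), V (i + 1) y = V i (emb y) * vframeU (dbarIterU i (unitsField (toUField (gaugeAct u U)))) y :=
    fun _ _ => rfl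
  -- (92): `dbar_{j′}((U♮)^{us 0}) = (Ū^{(j′)} U♮)^{V⁻¹·us}` for `us i := toUT (toMS u i)`
  have hUu : unitsField (toUField (gaugeAct u U)) = gaugeActT (toUT (toMS u 0)) (unitsField (toUField U)) := unitsField_toUField_gaugeAct u U
  have hVs' : ∀ (i : ℕ) (y : Site (F.P K) (i + 1)),
      V (i + 1) y = V i (emb y) * vframeU (dbarIterU i (gaugeActT (toUT (toMS u 0)) (unitsField (toUField U)))) y := by
    intro i y
    have h := hVs i y
    rwa [hUu] at h
  have h92 := dbarIterU_gaugeActT_eq (fun i => toUT (toMS u i)) (fun i y => toUT_toMS_succ u i y) (unitsField (toUField U)) V hV0 hVs' j'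
  -- the per-site equation at both ends of `c`
  have hsrc := hnorm hk V hV0 hVs j' hj' c.src hs
  have htgt := hnorm hk V hV0 hVs j' hj' c.tgt ht
  -- the representative's averages: `Ū^{(j′)}((U^{gw})♮) = (Ū^{(j′)} U♮)^{toUT (toMS gw j′)}`
  have hrep : emlIterU j' (unitsField (toUField (gaugeAct gw U))) = gaugeActT (toUT (toMS gw j')) (emlIterU j' (unitsField (toUField U))) := by
    rw [unitsField_toUField_gaugeAct]
    exact emlIterU_gaugeActT (fun i => toUT (toMS gw i)) (fun i y => toUT_toMS_succ gw i y) (unitsField (toUField U)) j'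
  rw [hUu, h92, hrep, gaugeActT_apply, gaugeActT_apply, hsrc, htgt]

/-- ★★ **THE TOP LEVEL**: under the predicate, at every top cell bond `c`, `U̿^{(j)}(U^u)(c) = Ū^{(j)}_{eml}((U^{h̄w})♮)(c)` AND the representative's record data are the record data,
`M^j(U^w) = M^jU` (`w` residual) — so the chart reads the top data in the rooted axial gauge `h` exactly as in 60′ (the guarded∕unguarded dictionary for `Ū^{(j)}_{eml}` is dag-n07-w2's
`emlIterU_unitsField_eq_iter_of_reads`, applied by the consumer under its smallness). [cite: Balaban1985Variational, (147) p.301, (154) p.302; Balaban1985Averaging, (92) p.31] -/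
theorem NrmDbarOfRecord.dbar_eq_top_dataAxial {Mc ρ : ℕ} {ν : Stage7Numerics} {M : ℕ} {g : ℕ → ℝ} {K k : ℕ}
    {s : SeqOfRecord F ν M g K k} {U : GaugeField (F.P K) 0 (SU N)} {j : ℕ} {idx : Pt (F.P K).d} {u : GaugeTransf (F.P K) 0 (SU N)}
    {A : PBond (F.P K) 0 → MatA N} (hN : NrmDbarOfRecord F N Mc ρ ν M g K k s U j idx u A) (hk : j ≤ (F.P K).m + (F.P K).K) :
    ∃ w : GaugeTransf (F.P K) 0 (SU N), IsResidual j w ∧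
      (∀ i < j, AxialGauge (radialContourData (F.P K) i (SU N)) (Averaging.iter (avOfRecord F N K) i (gaugeAct w U))) ∧
      Averaging.iter (avOfRecord F N K) j (gaugeAct w U) = Averaging.iter (avOfRecord F N K) j U ∧
      ∀ c : PBond (F.P K) j,
        (domainsMeet (cubeDomains (F.P K) (cornerP (F.P K) Mc ρ idx) (sideP (F.P K) Mc ρ) ρ j hk) (domainsOfSeq s.Ω j hk)).LamSite j c.src →
        (domainsMeet (cubeDomains (F.P K) (cornerP (F.P K) Mc ρ idx) (sideP (F.P K) Mc ρ) ρ j hk) (domainsOfSeq s.Ω j hk)).LamSite j c.tgt →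
          dbarIterU j (unitsField (toUField (gaugeAct u U))) c =
            emlIterU j (unitsField (toUField (gaugeAct (fun x => blockLift j (axialGaugeAt (Averaging.iter (avOfRecord F N K) j (gaugeAct w U))
              (tLo (cornerP (F.P K) Mc ρ idx) ρ) (tHi (cornerP (F.P K) Mc ρ idx) (sideP (F.P K) Mc ρ) ρ) (ctr (cornerP (F.P K) Mc ρ idx) (sideP (F.P K) Mc ρ))) x * w x) U))) c := by
  obtain ⟨w, hres, hax, hrep⟩ := hN.dbar_eq_iter_rep hk
  exact ⟨w, hres, hax, B12GaugeOrbits021.iter_gaugeAct_of_isResidual (avOfRecord F N K) hk hres U, fun c hs ht => hrep j le_rfl c hs ht⟩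

end Derived

end Summit.QuantumFields.YangMills.BalabanUVNodes.N07NormalisationDbarFrames

end
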